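/-
Copyright (c) 2026 the pub-hodgecm-mathlib formalisation cell (harness21).  Prover seat hodgecm-mathlib-K2E1-p15 (g4), Track B ∕ K2-LIT, h413 = `stmt-HodgeConjecture-24833`, route `HCCMUnconditional`,
R90-TF section S8 «ContSpec-n½», ESTATE T pure-type side (S8 dealer R90-CS-plan (g3), S8-R224 (3) 2026-09-05T02:28:05Z): the `hVτ` GLUE — a `K_max`-irreducible block IS `W`-isotypic.
-/
import Summits.HodgeConjecture.HodgeConjecture.Theorems.R90S8ResGMidAtomTauPureSplitU3   -- ★ p864443 (K2E1-p12): §5a `le_chiSectionSpacePairKType_of_kMax_irreducible` (pattern + helpers: `archMaximalCompact_le_kMax`, `finAdelicToAdelic_mem_kMax`,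
                                                                                          --   `rightTranslation_arch_fin_comm`); brings ★ (3′) p863637 `chiSectionSpacePairKType`, ★ `Representation.homRangeSum` API, ★ GKModulesProofs, ★ τ-DEFS
import HarnessLib

/-!
# S8 ESTATE T — `R90S8PureBlockIsotypicU3`: THE `hVτ` GLUE — A `K_max`-IRREDUCIBLE BLOCK OF PAIR-SECTIONS IS `W`-ISOTYPIC IN THE PORT'S CURRENCY: it is spanned by the images of its
# `K_∞`-equivariant copies of ONE irreducible `K_∞`-type `W₀ ≤ U` (read on `G_∞` through `ι`), and lies in the `τ`-part `V(…)^τ` of ★ (3′) for the same `τ = r|_{W₀}`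

Track B ∕ K2-LIT, crux h413 = `stmt-HodgeConjecture-24833`, route of record `HCCMUnconditional`; cell `hodgecm-mathlib`, R90-TF programme, section S8 «ContSpec-n½», ESTATE T (rulings J-S8-T2,
J-S8-T2′).  THEOREMS ONLY (no `def`, no `instance`, no `notation`, no named-fact hypothesis, no `sorry`; default heartbeats); lane `--supports stmt-HodgeConjecture-24833 --as helper`
(count-neutral).  CLOSES NO SOCKET.  CM print `U_{L∕L⁺}(3)`.

WHY.  The τ-ports (★ p864413 `K2E1ChiHeckeArchScalarTauU2`, ★ p864481 `…OfPorts`, ★ p864579 `R90S8MidWitnessExportsOfTU3`) consume the purity of a block `V` in the VOCABULARY-FREE shape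
`hVτ : V ≤ ⨆ (J : W →ₗ (G(𝔸) → ℂ)) (_ : range J ≤ V ∧ ∀ k ∈ K_∞, J v (x·ι k) = J (τ k v) x), range J` («`V` is spanned by its `K_∞`-equivariant copies of `W`»), with `τ : G_∞ → End W` a bare map
read on `K_∞ = ι⁻¹K`.  ★ §5 (K2E1-p12, `R90S8ResGMidAtomTauPureSplitU3`) delivers the blocks as `K_max`-IRREDUCIBLE finite-dimensional `K_max`-stable spaces `U` of pair-sections and proves (§5a)
`U ≤ V(…)^τ` for an irreducible `K_∞`-type `τ = r|_{W₀}`, `W₀ ≤ U` minimal `K_∞`-stable — whose proof in fact shows MORE: `U` EQUALS its own `τ`-part `D := (homRangeSum (r|_U ∘ K_∞) τ).map U.subtype`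
(`D ∋ W₀ ≠ 0` is `K_∞`-stable and `ι_f(G(𝒪̂)_f)`-stable — each `r(ι_f c)|_U` is a `K_∞`-intertwiner since `ι(K_∞)` and `ι_f(·)` commute — hence a non-zero `K_max`-subrepresentation of the
irreducible `U`).  THIS FILE re-runs that argument (★ §5a's proof, verbatim up to `U ≤ D`) and READS `U ≤ D` in the port's currency: `D = ⨆_T range (U.subtype ∘ T)` over the `K_∞`-maps
`T : W₀ → U`, each `J := U.subtype ∘ T` having `range J ≤ U` and `J (τ′ k v) = r(ι k)(J v)` for `k ∈ K_∞`, where `τ′ k := τ ⟨ι k, _⟩` (extended by `id` off `ι⁻¹(ι(K_∞))`, a `dite` — the bare map the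
ports take).  So for every block of ★ §5d, and for the `K_max`-block of a pure witness, the letter `hVτ` of ★ p864481 ∕ ★ p864579 is DISCHARGED, leaving THE LINE (`hline` ∕ `hco`) as the only
pure-type letter ([BrockerTomDieck1985, II (4.14)]: an irreducible representation of `K_∞ × K_f⁰` is `K_∞`-isotypic; [WallachRRG1, §1.4.6–1.4.7]).
* **`exists_isotypic_of_kMax_irreducible`** — ★ §5a's conclusion (`W₀ ≤ U`, f.d., irreducible `τ = r|_{W₀}`, `U ≤ V(…)^τ`) AND the port's `hVτ` for `U` at `(↥W₀, τ′)`.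
HONEST LABEL: HC_CM is proved only modulo the 7 printed citations (2 remaining named inputs: hLiu418 = `stmt-HodgeConjecture-24832`, h413 = `stmt-HodgeConjecture-24833`) until rung 0
closes; REL ≠ ★ ≠ BUILT; glue — pays no socket; the LINE per `K_∞`-type stays the T assembler's letter (★ p864279 + Frobenius–Riesz per arch place); count-neutral.

## References
* [BrockerTomDieck1985] T. Bröcker, T. tom Dieck, *Representations of Compact Lie Groups*, GTM 98 (1985), II (1.9), (4.14)–(4.15).
* [WallachRRG1] N. R. Wallach, *Real Reductive Groups I* (1988), §1.4.6–1.4.7 (`V(γ)`), §3.3.1.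
* [BorelJacquet1979] A. Borel, H. Jacquet, *Automorphic forms and automorphic representations*, Proc. Symp. Pure Math. 33.1 (1979), §4.1 (`K = K_∞·K_f`).
* [MoeglinWaldspurger1995] C. Mœglin, J.-L. Waldspurger, *Spectral Decomposition and Eisenstein Series* (1995), I.2.17.
-/

set_option autoImplicit false
set_option linter.dupNamespace false  -- the mandated namespace `…HodgeConjecture.HodgeConjecture.R90.S8` (LEAD #1 L1) repeats the summit's segment

noncomputable section

open MeasureTheory Measure Set Filter Topology NumberField ContRepresentation
open Literature.NumberTheory Literature.NumberTheory.Automorphic Literature.NumberTheory.Automorphic.UnitaryGroup Literature.NumberTheory.GaloisRepresentations AdelicGroupData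
open Literature.NumberTheory.Automorphic.Arthur2013.Leaves.TECR Literature.NumberTheory.Rogawski1990
open Summit.HodgeConjecture.HodgeConjecture.Cruxes.H413.K2E1BorelEisensteinU
open Summit.HodgeConjecture.HodgeConjecture.Cruxes.H413.K2E1CharacterEisensteinU3PairDefs
open Summit.HodgeConjecture.HodgeConjecture.Cruxes.H413.K2E1ChiSectionSpaceU3PairDefs
open scoped ENNReal NNReal

namespace Summit.HodgeConjecture.HodgeConjecture.R90.S8

variable (L : Type) [Field L] [NumberField L] [IsCMField L]
  {χ₁ : HeckeCharacter L} {χ₂ : ↥(TorusDict.torus (IsCMField.complexConj L)) →ₜ* ℂˣ}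

set_option maxHeartbeats 400000 in -- ★ §5a's proof re-run PLUS the `W`-isotypy read-back in ONE declaration exceed the default budget (each half alone stays under it); no search, no `decide`
/-- **THE `hVτ` GLUE — A `K_max`-IRREDUCIBLE BLOCK IS `W`-ISOTYPIC** (★ §5a `le_chiSectionSpacePairKType_of_kMax_irreducible` re-run, its internal `U ≤ D` exported in the port's currency): let
`U ≤ V(χ₁, χ₂; K′, ω)` be a finite-dimensional `K_max`-stable space of pair-sections on which `r(K_max)` is IRREDUCIBLE, the level `K′` commuting with `ι(K_∞)` (`hcomm`).  Then there is a minimal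
`K_∞`-stable `W₀ ≤ U` — an irreducible finite-dimensional `K_∞`-type `τ := r|_{W₀}` — with (i) `U ≤ V(χ₁, χ₂; K′, ω)^τ` (★ (3′)) and (ii) THE PORT'S `hVτ`: `U ≤ ⨆_J range J` over the linear
`J : W₀ → (G(𝔸) → ℂ)` with `range J ≤ U` and `J v (x·ι k) = J (τ′ k v) x` for `k ∈ K_∞ = ι⁻¹K`, `τ′ = τ ⟨ι ·, _⟩` on `ι⁻¹ι(K_∞)` (an `∃ τ′` with this specification) — the `J`'s being `U.subtype ∘ T` for the
`K_∞`-maps `T : W₀ → U` whose ranges sum to `U`'s `τ`-part `= U`. [cite: BrockerTomDieck1985, II (4.14)] [cite: WallachRRG1, §1.4.6–1.4.7] [cite: BorelJacquet1979, §4.1] -/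
theorem exists_isotypic_of_kMax_irreducible {K' : Subgroup (quasiSplit (↥(maximalRealSubfield L)) L (IsCMField.complexConj L) 3).Adelic} {ω : ↥K' → ℂ}
    (hcomm : ∀ k : ↥(archMaximalCompact L), ∀ k' ∈ K', k' * (k : (quasiSplit (↥(maximalRealSubfield L)) L (IsCMField.complexConj L) 3).Adelic) = (k : (quasiSplit (↥(maximalRealSubfield L)) L (IsCMField.complexConj L) 3).Adelic) * k')
    (U : Submodule ℂ ((quasiSplit (↥(maximalRealSubfield L)) L (IsCMField.complexConj L) 3).Adelic → ℂ)) (hU : ∀ k : ↥((standardMaximalCompactGL 3 L).comap (adelicVal (↥(maximalRealSubfield L)) L (IsCMField.complexConj L) 3 ((StdForm.antidiagonal 3).over L)) : Subgroup (quasiSplit (↥(maximalRealSubfield L)) L (IsCMField.complexConj L) 3).Adelic), ∀ ψ ∈ U, ((rightTranslation (quasiSplit (↥(maximalRealSubfield L)) L (IsCMField.complexConj L) 3)).comp ((standardMaximalCompactGL 3 L).comap (adelicVal (↥(maximalRealSubfield L)) L (IsCMField.complexConj L) 3 ((StdForm.antidiagonal 3).over L)) : Subgroup (quasiSplit (↥(maximalRealSubfield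 L)) L (IsCMField.complexConj L) 3).Adelic).subtype) k ψ ∈ U) [hUfd : FiniteDimensional ℂ ↥U]
    (hirr : (Subrepresentation.toRepresentation (⟨U, hU⟩ : Subrepresentation ((rightTranslation (quasiSplit (↥(maximalRealSubfield L)) L (IsCMField.complexConj L) 3)).comp ((standardMaximalCompactGL 3 L).comap (adelicVal (↥(maximalRealSubfield L)) L (IsCMField.complexConj L) 3 ((StdForm.antidiagonal 3).over L)) : Subgroup (quasiSplit (↥(maximalRealSubfield L)) L (IsCMField.complexConj L) 3).Adelic).subtype))).IsIrreducible) (hUV : U ≤ chiSectionSpacePair χ₁ χ₂ K' ω) :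
    ∃ (W₀ : Submodule ℂ ((quasiSplit (↥(maximalRealSubfield L)) L (IsCMField.complexConj L) 3).Adelic → ℂ)) (hW₀K : ∀ k : ↥(archMaximalCompact L), ∀ ψ ∈ W₀, ((rightTranslation (quasiSplit (↥(maximalRealSubfield L)) L (IsCMField.complexConj L) 3)).comp (archMaximalCompact L).subtype) k ψ ∈ W₀),
      W₀ ≤ U ∧ FiniteDimensional ℂ ↥W₀ ∧ (Subrepresentation.toRepresentation (⟨W₀, hW₀K⟩ : Subrepresentation ((rightTranslation (quasiSplit (↥(maximalRealSubfield L)) L (IsCMField.complexConj L) 3)).comp (archMaximalCompact L).subtype))).IsIrreducible ∧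
      U ≤ chiSectionSpacePairKType χ₁ χ₂ K' ω (archMaximalCompact L).subtype hcomm (Subrepresentation.toRepresentation (⟨W₀, hW₀K⟩ : Subrepresentation ((rightTranslation (quasiSplit (↥(maximalRealSubfield L)) L (IsCMField.complexConj L) 3)).comp (archMaximalCompact L).subtype))) ∧
      ∃ τ' : ↥(arch (↥(maximalRealSubfield L)) L (IsCMField.complexConj L) 3 ((StdForm.antidiagonal 3).over L)) → (↥W₀ →ₗ[ℂ] ↥W₀),
        (∀ (a : ↥(arch (↥(maximalRealSubfield L)) L (IsCMField.complexConj L) 3 ((StdForm.antidiagonal 3).over L))) (ha : archToAdelic (↥(maximalRealSubfield L)) L (IsCMField.complexConj L) 3 ((StdForm.antidiagonal 3).over L) a ∈ archMaximalCompact L), τ' a = (Subrepresentation.toRepresentation (⟨W₀, hW₀K⟩ : Subrepresentation ((rightTranslation (quasiSplit (↥(maximalRealSubfield L)) L (IsCMField.complexConj L) 3)).comp (archMaximalCompact L).subtype))) ⟨archToAdelic (↥(maximalRealSubfield L)) L (IsCMField.complexConj L) 3 ((StdForm.antidiagonal 3).over L) a, ha⟩) ∧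
        U ≤ ⨆ (J : ↥W₀ →ₗ[ℂ] ((quasiSplit (↥(maximalRealSubfield L)) L (IsCMField.complexConj L) 3).Adelic → ℂ)) (_ : LinearMap.range J ≤ U ∧
            ∀ k ∈ (((standardMaximalCompactGL 3 L).comap (adelicVal (↥(maximalRealSubfield L)) L (IsCMField.complexConj L) 3 ((StdForm.antidiagonal 3).over L))).comap (archToAdelic (↥(maximalRealSubfield L)) L (IsCMField.complexConj L) 3 ((StdForm.antidiagonal 3).over L))),
              ∀ (v : ↥W₀) (x : (quasiSplit (↥(maximalRealSubfield L)) L (IsCMField.complexConj L) 3).Adelic), J v (x * archToAdelic (↥(maximalRealSubfield L)) L (IsCMField.complexConj L) 3 ((StdForm.antidiagonal 3).over L) k) = J (τ' k v) x),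
          LinearMap.range J := by
  -- `K_∞ ≤ K_max` acts on `U`
  have hUinf : ∀ k : ↥(archMaximalCompact L), ∀ ψ ∈ U, ((rightTranslation (quasiSplit (↥(maximalRealSubfield L)) L (IsCMField.complexConj L) 3)).comp (archMaximalCompact L).subtype) k ψ ∈ U := fun k ψ hψ =>
    hU ⟨(k : (quasiSplit (↥(maximalRealSubfield L)) L (IsCMField.complexConj L) 3).Adelic), archMaximalCompact_le_kMax L k.2⟩ ψ hψ
  -- `U ≠ ⊥` (an irreducible representation space is non-trivial)
  have hU0 : U ≠ ⊥ := by
    haveI := hirr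
    obtain ⟨P, Q, hPQ⟩ := exists_pair_ne (Subrepresentation (Subrepresentation.toRepresentation (⟨U, hU⟩ : Subrepresentation ((rightTranslation (quasiSplit (↥(maximalRealSubfield L)) L (IsCMField.complexConj L) 3)).comp ((standardMaximalCompactGL 3 L).comap (adelicVal (↥(maximalRealSubfield L)) L (IsCMField.complexConj L) 3 ((StdForm.antidiagonal 3).over L)) : Subgroup (quasiSplit (↥(maximalRealSubfield L)) L (IsCMField.complexConj L) 3).Adelic).subtype))))
    have hnt : Nontrivial (Submodule ℂ ↥U) := ⟨⟨P.toSubmodule, Q.toSubmodule, fun h => hPQ (Subrepresentation.toSubmodule_injective h)⟩⟩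
    exact Submodule.nontrivial_iff_ne_bot.1 ((Submodule.nontrivial_iff ℂ).1 hnt)
  -- a minimal non-zero `K_∞`-stable `W₀ ≤ U`; it is irreducible
  obtain ⟨W₀, hW₀U, hW₀ne, hW₀K, hW₀min⟩ := Literature.NumberTheory.Automorphic.exists_minimal_stable_submodule ((rightTranslation (quasiSplit (↥(maximalRealSubfield L)) L (IsCMField.complexConj L) 3)).comp (archMaximalCompact L).subtype) U hU0 hUinf
  haveI hW₀fd : FiniteDimensional ℂ ↥W₀ := Submodule.finiteDimensional_of_le hW₀U
  haveI : Nontrivial ↥W₀ := Submodule.nontrivial_iff_ne_bot.2 hW₀ne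
  have hirr₀ : (Subrepresentation.toRepresentation (⟨W₀, hW₀K⟩ : Subrepresentation ((rightTranslation (quasiSplit (↥(maximalRealSubfield L)) L (IsCMField.complexConj L) 3)).comp (archMaximalCompact L).subtype))).IsIrreducible := by
    refine Literature.NumberTheory.Automorphic.isIrreducible_of_intertwiningMap_injective ((rightTranslation (quasiSplit (↥(maximalRealSubfield L)) L (IsCMField.complexConj L) 3)).comp (archMaximalCompact L).subtype)
      ({ toLinearMap := W₀.subtype, isIntertwining' := fun k => rfl } : (Subrepresentation.toRepresentation (⟨W₀, hW₀K⟩ : Subrepresentation ((rightTranslation (quasiSplit (↥(maximalRealSubfield L)) L (IsCMField.complexConj L) 3)).comp (archMaximalCompact L).subtype))).IntertwiningMap ((rightTranslation (quasiSplit (↥(maximalRealSubfield L)) L (IsCMField.complexConj L) 3)).comp (archMaximalCompact L).subtype)) Subtype.val_injective fun U' hU' hU'le => ?_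
    have hr : LinearMap.range W₀.subtype = W₀ := Submodule.range_subtype W₀
    change U' ≤ LinearMap.range W₀.subtype at hU'le
    change U' = ⊥ ∨ U' = LinearMap.range W₀.subtype
    rw [hr] at hU'le ⊢
    exact hW₀min U' hU' hU'le
  -- `W₀ ↪ U` is a `K_∞`-map `τ → r|_U`; the `τ`-part `T` of `U`, pushed into `G(𝔸) → ℂ`, is `D := T.map U.subtype ∋ W₀`
  let j : (Subrepresentation.toRepresentation (⟨W₀, hW₀K⟩ : Subrepresentation ((rightTranslation (quasiSplit (↥(maximalRealSubfield L)) L (IsCMField.complexConj L) 3)).comp (archMaximalCompact L).subtype))).IntertwiningMap (Subrepresentation.toRepresentation (⟨U, hUinf⟩ : Subrepresentation ((rightTranslation (quasiSplit (↥(maximalRealSubfield L)) L (IsCMField.complexConj L) 3)).comp (archMaximalCompact L).subtype))) :=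
    { toLinearMap := LinearMap.codRestrict U W₀.subtype fun w => hW₀U w.2
      isIntertwining' := fun k => LinearMap.ext fun w => Subtype.ext rfl }
  -- `T` is `K_max`-stable: `k = ι(a)·ι_f(c)`, `r(ι_f c)|_U` is a `K_∞`-intertwiner, `r(ι a)` preserves the `τ`-part
  have hTK : ∀ k : ↥((standardMaximalCompactGL 3 L).comap (adelicVal (↥(maximalRealSubfield L)) L (IsCMField.complexConj L) 3 ((StdForm.antidiagonal 3).over L)) : Subgroup (quasiSplit (↥(maximalRealSubfield L)) L (IsCMField.complexConj L) 3).Adelic), ∀ v ∈ Representation.homRangeSum (Subrepresentation.toRepresentation (⟨U, hUinf⟩ : Subrepresentation ((rightTranslation (quasiSplit (↥(maximalRealSubfield L)) L (IsCMField.complexConj L) 3)).comp (archMaximalCompact L).subtype))) (Subrepresentation.toRepresentation (⟨W₀, hW₀K⟩ : Subrepresentation ((rightTranslation (quasiSplit (↥(maximalRealSubfield L)) L (IsCMField.complexConj L) 3)).comp (archMaximalCompact L).subtype))), (Subrepresentation.toRepresentation (⟨U, hU⟩ : Subrepresentation ((rightTranslation (quasiSplit (↥(maximalRealSubfield L)) L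 (IsCMField.complexConj L) 3)).comp ((standardMaximalCompactGL 3 L).comap (adelicVal (↥(maximalRealSubfield L)) L (IsCMField.complexConj L) 3 ((StdForm.antidiagonal 3).over L)) : Subgroup (quasiSplit (↥(maximalRealSubfield L)) L (IsCMField.complexConj L) 3).Adelic).subtype))) k v ∈ Representation.homRangeSum (Subrepresentation.toRepresentation (⟨U, hUinf⟩ : Subrepresentation ((rightTranslation (quasiSplit (↥(maximalRealSubfield L)) L (IsCMField.complexConj L) 3)).comp (archMaximalCompact L).subtype))) (Subrepresentation.toRepresentation (⟨W₀, hW₀K⟩ : Subrepresentation ((rightTranslation (quasiSplit (↥(maximalRealSubfield L)) L (IsCMField.complexConj L) 3)).comp (archMaximalCompact L).subtype))) := by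
    intro k v hv
    obtain ⟨a, c, haK, hcK, hk_eq⟩ : ∃ (a : ↥(arch (↥(maximalRealSubfield L)) L (IsCMField.complexConj L) 3 ((StdForm.antidiagonal 3).over L))) (c : ↥(finAdelic (↥(maximalRealSubfield L)) L (IsCMField.complexConj L) 3 ((StdForm.antidiagonal 3).over L))), (adelicVal (↥(maximalRealSubfield L)) L (IsCMField.complexConj L) 3 ((StdForm.antidiagonal 3).over L)) ((archToAdelic (↥(maximalRealSubfield L)) L (IsCMField.complexConj L) 3 ((StdForm.antidiagonal 3).over L)) a) ∈ standardMaximalCompactGL 3 L ∧ c ∈ (finAdelicIntegralLevel (↥(maximalRealSubfield L)) L (IsCMField.complexConj L) 3 ((StdForm.antidiagonal 3).over L)) ∧ (k : (quasiSplit (↥(maximalRealSubfield L)) L (IsCMField.complexConj L) 3).Adelic) = (archToAdelic (↥(maximalRealSubfield L)) L (IsCMField.complexConj L) 3 ((StdForm.antidiagonal 3).over L)) a * (finAdelicToAdelic (↥(maximalRealSubfield L)) L (IsCMField.complexConj L) 3 ((StdForm.antidiagonal 3).over L)) c :=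
      ⟨_, _, adelicVal_archToAdelic_archPart_mem L k.2, finPart_mem_finAdelicIntegralLevel L k.2, (archToAdelic_mul_finAdelicToAdelic _ _ _ _ _ _).symm⟩
    let F : (Subrepresentation.toRepresentation (⟨U, hUinf⟩ : Subrepresentation ((rightTranslation (quasiSplit (↥(maximalRealSubfield L)) L (IsCMField.complexConj L) 3)).comp (archMaximalCompact L).subtype))).IntertwiningMap (Subrepresentation.toRepresentation (⟨U, hUinf⟩ : Subrepresentation ((rightTranslation (quasiSplit (↥(maximalRealSubfield L)) L (IsCMField.complexConj L) 3)).comp (archMaximalCompact L).subtype))) :=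
      { toLinearMap := (Subrepresentation.toRepresentation (⟨U, hU⟩ : Subrepresentation ((rightTranslation (quasiSplit (↥(maximalRealSubfield L)) L (IsCMField.complexConj L) 3)).comp ((standardMaximalCompactGL 3 L).comap (adelicVal (↥(maximalRealSubfield L)) L (IsCMField.complexConj L) 3 ((StdForm.antidiagonal 3).over L)) : Subgroup (quasiSplit (↥(maximalRealSubfield L)) L (IsCMField.complexConj L) 3).Adelic).subtype))) ⟨(finAdelicToAdelic (↥(maximalRealSubfield L)) L (IsCMField.complexConj L) 3 ((StdForm.antidiagonal 3).over L)) c, finAdelicToAdelic_mem_kMax L hcK⟩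
        isIntertwining' := fun k' => LinearMap.ext fun u => Subtype.ext (by
          obtain ⟨-, a', ha'⟩ := (mem_archMaximalCompact_iff L (k' : (quasiSplit (↥(maximalRealSubfield L)) L (IsCMField.complexConj L) 3).Adelic)).1 k'.2
          show (rightTranslation (quasiSplit (↥(maximalRealSubfield L)) L (IsCMField.complexConj L) 3)) ((finAdelicToAdelic (↥(maximalRealSubfield L)) L (IsCMField.complexConj L) 3 ((StdForm.antidiagonal 3).over L)) c) ((rightTranslation (quasiSplit (↥(maximalRealSubfield L)) L (IsCMField.complexConj L) 3)) (k' : (quasiSplit (↥(maximalRealSubfield L)) L (IsCMField.complexConj L) 3).Adelic) (u : (quasiSplit (↥(maximalRealSubfield L)) L (IsCMField.complexConj L) 3).Adelic → ℂ)) = (rightTranslation (quasiSplit (↥(maximalRealSubfield L)) L (IsCMField.complexConj L) 3)) (k' : (quasiSplit (↥(maximalRealSubfield L)) L (IsCMField.complexConj L) 3).Adelic) ((rightTranslation (quasiSplit (↥(maximalRealSubfield L)) L (IsCMField.complexConj L) 3)) ((finAdelicToAdelic (↥(maximalRealSubfield L)) L (IsCMField.complexConj L) 3 ((StdForm.antidiagonal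 3).over L)) c) (u : (quasiSplit (↥(maximalRealSubfield L)) L (IsCMField.complexConj L) 3).Adelic → ℂ))
          rw [← ha', rightTranslation_arch_fin_comm]) }
    have h1 : (Subrepresentation.toRepresentation (⟨U, hU⟩ : Subrepresentation ((rightTranslation (quasiSplit (↥(maximalRealSubfield L)) L (IsCMField.complexConj L) 3)).comp ((standardMaximalCompactGL 3 L).comap (adelicVal (↥(maximalRealSubfield L)) L (IsCMField.complexConj L) 3 ((StdForm.antidiagonal 3).over L)) : Subgroup (quasiSplit (↥(maximalRealSubfield L)) L (IsCMField.complexConj L) 3).Adelic).subtype))) ⟨(finAdelicToAdelic (↥(maximalRealSubfield L)) L (IsCMField.complexConj L) 3 ((StdForm.antidiagonal 3).over L)) c, finAdelicToAdelic_mem_kMax L hcK⟩ v ∈ Representation.homRangeSum (Subrepresentation.toRepresentation (⟨U, hUinf⟩ : Subrepresentation ((rightTranslation (quasiSplit (↥(maximalRealSubfield L)) L (IsCMField.complexConj L) 3)).comp (archMaximalCompact L).subtype))) (Subrepresentation.toRepresentation (⟨W₀, hW₀K⟩ : Subrepresentation ((rightTranslation (quasiSplit (↥(maximalRealSubfield L))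 L (IsCMField.complexConj L) 3)).comp (archMaximalCompact L).subtype))) :=
      Representation.map_homRangeSum_le F ⟨v, hv, rfl⟩
    have h2 := Representation.apply_mem_homRangeSum_of_mem (ρ := (Subrepresentation.toRepresentation (⟨U, hUinf⟩ : Subrepresentation ((rightTranslation (quasiSplit (↥(maximalRealSubfield L)) L (IsCMField.complexConj L) 3)).comp (archMaximalCompact L).subtype)))) (⟨(archToAdelic (↥(maximalRealSubfield L)) L (IsCMField.complexConj L) 3 ((StdForm.antidiagonal 3).over L)) a, archToAdelic_mem_archMaximalCompact L a haK⟩ : ↥(archMaximalCompact L)) h1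
    have h3 : (Subrepresentation.toRepresentation (⟨U, hU⟩ : Subrepresentation ((rightTranslation (quasiSplit (↥(maximalRealSubfield L)) L (IsCMField.complexConj L) 3)).comp ((standardMaximalCompactGL 3 L).comap (adelicVal (↥(maximalRealSubfield L)) L (IsCMField.complexConj L) 3 ((StdForm.antidiagonal 3).over L)) : Subgroup (quasiSplit (↥(maximalRealSubfield L)) L (IsCMField.complexConj L) 3).Adelic).subtype))) k v = (Subrepresentation.toRepresentation (⟨U, hUinf⟩ : Subrepresentation ((rightTranslation (quasiSplit (↥(maximalRealSubfield L)) L (IsCMField.complexConj L) 3)).comp (archMaximalCompact L).subtype))) ⟨(archToAdelic (↥(maximalRealSubfield L)) L (IsCMField.complexConj L) 3 ((StdForm.antidiagonal 3).over L)) a, archToAdelic_mem_archMaximalCompact L a haK⟩ ((Subrepresentation.toRepresentation (⟨U, hU⟩ : Subrepresentation ((rightTranslation (quasiSplit (↥(maximalRealSubfield L)) L (IsCMField.complexConj L) 3)).comp ((standardMaximalCompactGL 3 L).comap (adelicVal (↥(maximalRealSubfield L)) L (IsCMField.complexConj L) 3 ((StdForm.antidiagonal 3).over L)) : Subgroup (quasiSplit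 (↥(maximalRealSubfield L)) L (IsCMField.complexConj L) 3).Adelic).subtype))) ⟨(finAdelicToAdelic (↥(maximalRealSubfield L)) L (IsCMField.complexConj L) 3 ((StdForm.antidiagonal 3).over L)) c, finAdelicToAdelic_mem_kMax L hcK⟩ v) :=
      Subtype.ext (by
        show (rightTranslation (quasiSplit (↥(maximalRealSubfield L)) L (IsCMField.complexConj L) 3)) (k : (quasiSplit (↥(maximalRealSubfield L)) L (IsCMField.complexConj L) 3).Adelic) (v : (quasiSplit (↥(maximalRealSubfield L)) L (IsCMField.complexConj L) 3).Adelic → ℂ) = (rightTranslation (quasiSplit (↥(maximalRealSubfield L)) L (IsCMField.complexConj L) 3)) ((archToAdelic (↥(maximalRealSubfield L)) L (IsCMField.complexConj L) 3 ((StdForm.antidiagonal 3).over L)) a) ((rightTranslation (quasiSplit (↥(maximalRealSubfield L)) L (IsCMField.complexConj L) 3)) ((finAdelicToAdelic (↥(maximalRealSubfield L)) L (IsCMField.complexConj L) 3 ((StdForm.antidiagonal 3).over L)) c) (v : (quasiSplit (↥(maximalRealSubfield L)) L (IsCMField.complexConj L) 3).Adelic → ℂ))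
        rw [hk_eq, rightTranslation_mul_apply])
    rw [h3]
    exact h2
  -- `D := T.map U.subtype` is `K_max`-stable and contains a non-zero vector of the irreducible `U`, hence `U ≤ D` (★ `submodule_le_of_isIrreducible`)
  have hD : ∀ k : ↥((standardMaximalCompactGL 3 L).comap (adelicVal (↥(maximalRealSubfield L)) L (IsCMField.complexConj L) 3 ((StdForm.antidiagonal 3).over L)) : Subgroup (quasiSplit (↥(maximalRealSubfield L)) L (IsCMField.complexConj L) 3).Adelic), ∀ v ∈ (Representation.homRangeSum (Subrepresentation.toRepresentation (⟨U, hUinf⟩ : Subrepresentation ((rightTranslation (quasiSplit (↥(maximalRealSubfield L)) L (IsCMField.complexConj L) 3)).comp (archMaximalCompact L).subtype))) (Subrepresentation.toRepresentation (⟨W₀, hW₀K⟩ : Subrepresentation ((rightTranslation (quasiSplit (↥(maximalRealSubfield L)) L (IsCMField.complexConj L) 3)).comp (archMaximalCompact L).subtype)))).map U.subtype, ((rightTranslation (quasiSplit (↥(maximalRealSubfield L)) L (IsCMField.complexConj L) 3)).comp ((standardMaximalCompactGL 3 L).comap (adelicVal (↥(maximalRealSubfield L)) L (IsCMField.complexConj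 L) 3 ((StdForm.antidiagonal 3).over L)) : Subgroup (quasiSplit (↥(maximalRealSubfield L)) L (IsCMField.complexConj L) 3).Adelic).subtype) k v ∈ (Representation.homRangeSum (Subrepresentation.toRepresentation (⟨U, hUinf⟩ : Subrepresentation ((rightTranslation (quasiSplit (↥(maximalRealSubfield L)) L (IsCMField.complexConj L) 3)).comp (archMaximalCompact L).subtype))) (Subrepresentation.toRepresentation (⟨W₀, hW₀K⟩ : Subrepresentation ((rightTranslation (quasiSplit (↥(maximalRealSubfield L)) L (IsCMField.complexConj L) 3)).comp (archMaximalCompact L).subtype)))).map U.subtype := by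
    rintro k _ ⟨t, ht, rfl⟩
    exact ⟨_, hTK k t ht, rfl⟩
  obtain ⟨w, hw, hw0⟩ := (Submodule.ne_bot_iff W₀).1 hW₀ne
  have hUD : U ≤ (Representation.homRangeSum (Subrepresentation.toRepresentation (⟨U, hUinf⟩ : Subrepresentation ((rightTranslation (quasiSplit (↥(maximalRealSubfield L)) L (IsCMField.complexConj L) 3)).comp (archMaximalCompact L).subtype))) (Subrepresentation.toRepresentation (⟨W₀, hW₀K⟩ : Subrepresentation ((rightTranslation (quasiSplit (↥(maximalRealSubfield L)) L (IsCMField.complexConj L) 3)).comp (archMaximalCompact L).subtype)))).map U.subtype :=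
    submodule_le_of_isIrreducible ((rightTranslation (quasiSplit (↥(maximalRealSubfield L)) L (IsCMField.complexConj L) 3)).comp ((standardMaximalCompactGL 3 L).comap (adelicVal (↥(maximalRealSubfield L)) L (IsCMField.complexConj L) 3 ((StdForm.antidiagonal 3).over L)) : Subgroup (quasiSplit (↥(maximalRealSubfield L)) L (IsCMField.complexConj L) 3).Adelic).subtype) hU hirr hD (hW₀U hw) ⟨j ⟨w, hw⟩, Representation.apply_mem_homRangeSum j ⟨w, hw⟩, rfl⟩ hw0
  refine ⟨W₀, hW₀K, hW₀U, hW₀fd, hirr₀, ?_, ?_⟩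
  · -- push `U ≤ D` into `V^τ` along the `K_∞`-map `U ↪ V(χ₁, χ₂; K′, ω)`
    intro ψ hψ
    obtain ⟨t, ht, hteq⟩ := hUD hψ
    have htψ : t = ⟨ψ, hψ⟩ := Subtype.ext hteq
    rw [htψ] at ht
    let incl : (Subrepresentation.toRepresentation (⟨U, hUinf⟩ : Subrepresentation ((rightTranslation (quasiSplit (↥(maximalRealSubfield L)) L (IsCMField.complexConj L) 3)).comp (archMaximalCompact L).subtype))).IntertwiningMap (chiSectionPairSubrep χ₁ χ₂ K' ω (archMaximalCompact L).subtype hcomm).toRepresentation :=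
      { toLinearMap := LinearMap.codRestrict (chiSectionSpacePair χ₁ χ₂ K' ω) U.subtype fun u => hUV u.2
        isIntertwining' := fun k => LinearMap.ext fun u => Subtype.ext rfl }
    exact (mem_chiSectionSpacePairKType_iff ψ).2 ⟨hUV hψ, Representation.map_homRangeSum_le incl ⟨⟨ψ, hψ⟩, ht, rfl⟩⟩
  · -- `U ≤ D` read as `W`-ISOTYPY in the port's currency: `D` is the sum of the ranges of the `K_∞`-maps `T : W₀ → U`, pushed into `G(𝔸) → ℂ` as `J := U.subtype ∘ T`; the bare map `τ′` on `G_∞`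
    -- is `τ` on `ι⁻¹ι(K_∞)` and `id` elsewhere (a `dite` on the classical instance, kept OUT of the statement)
    refine ⟨fun a => @dite _ (archToAdelic (↥(maximalRealSubfield L)) L (IsCMField.complexConj L) 3 ((StdForm.antidiagonal 3).over L) a ∈ archMaximalCompact L) (Classical.propDecidable _)
      (fun h => (Subrepresentation.toRepresentation (⟨W₀, hW₀K⟩ : Subrepresentation ((rightTranslation (quasiSplit (↥(maximalRealSubfield L)) L (IsCMField.complexConj L) 3)).comp (archMaximalCompact L).subtype))) ⟨archToAdelic (↥(maximalRealSubfield L)) L (IsCMField.complexConj L) 3 ((StdForm.antidiagonal 3).over L) a, h⟩) (fun _ => LinearMap.id), fun a ha => dif_pos ha, ?_⟩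
    intro ψ hψ
    obtain ⟨t, ht, hteq⟩ := hUD hψ
    rw [← hteq]
    refine Submodule.iSup_induction _ (motive := fun t : ↥U => U.subtype t ∈ _) ht (fun T t' ht' => ?_) (by rw [map_zero]; exact Submodule.zero_mem _) fun x y hx hy => by
      rw [map_add]; exact Submodule.add_mem _ hx hy
    obtain ⟨w, rfl⟩ := LinearMap.mem_range.1 ht'
    refine Submodule.mem_iSup_of_mem (U.subtype ∘ₗ T.toLinearMap) (Submodule.mem_iSup_of_mem ⟨?_, fun k hk v x => ?_⟩ (LinearMap.mem_range_self _ w))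
    · rintro _ ⟨v, rfl⟩
      exact (T.toLinearMap v).2
    · have hkK : archToAdelic (↥(maximalRealSubfield L)) L (IsCMField.complexConj L) 3 ((StdForm.antidiagonal 3).over L) k ∈ archMaximalCompact L := archToAdelic_mem_archMaximalCompact L k (Subgroup.mem_comap.1 (Subgroup.mem_comap.1 hk))
      -- `T (τ k v) = r(ι k) (T v)` in `U`; read at `x`
      have hT := LinearMap.congr_fun (T.isIntertwining' ⟨archToAdelic (↥(maximalRealSubfield L)) L (IsCMField.complexConj L) 3 ((StdForm.antidiagonal 3).over L) k, hkK⟩) v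
      simp only [LinearMap.coe_comp, Function.comp_apply] at hT
      simp only [LinearMap.coe_comp, Function.comp_apply, Submodule.coe_subtype, dif_pos hkK]
      rw [hT]
      rfl

end Summit.HodgeConjecture.HodgeConjecture.R90.S8

end
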